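import Literature.NumberTheory.Automorphic.UnramifiedHeckeScalars
import Literature.NumberTheory.Automorphic.JacquetLanglandsParts
import Literature.NumberTheory.Automorphic.Sweep1Proofs
import Literature.NumberTheory.Automorphic.AutomorphicGLn
import HarnessLib

/-!
# Unramified Hecke operators do not depend on the level away from `v`; Satake parameters of
cuspidal representations are level-free; uniqueness of cuspidal weak base-change lifts

Fourth layer of the decomposition of the named fact
`Literature.NumberTheory.Automorphic.exists_cuspidal_baseChange_of_not_dvd` (**lang.S23**, `Literature/…/Sweep1.lean`;
Arthur–Clozel, *Simple algebras, base change, and the advanced theory of the trace formula*,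
Ann. of Math. Stud. 120 (1989), Ch. 3, Thm. 4.2 (a)). The earlier layers are
`Sweep1Proofs` (Def. 1.1 `IsWeakBaseChangeLift`, the named fact
`ArthurClozel1989_exists_cuspidal_weakLift_or_dvd` = Thm. 4.2 (a)–(b), assembly),
`PairLFunctionBaseChange` (Lemma 4.3, proved) and `UnramifiedHeckeScalars`
(`exists_hasSatakeParameterAt_cofinite` from two named facts). This file sharpens the two
places where the tree's language of Satake parameters — `HasSatakeParameterAt W K(𝔫) v ϖ α`,
"`W` has a `K(𝔫)`-fixed common eigenvector of the `T_{v,i}` with eigenvalues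
`q_v^{i(n-i)/2} e_i(α)`", a notion *relative to a level* `K(𝔫)` — meets Arthur–Clozel's
level-free Hecke matrices `t_{π,v}`, and it proves the uniqueness clause of Thm. 4.2 (a) for
cuspidal lifts modulo the named facts it rests on in print. Everything in this file is
**proved** (no new named fact):

* `heckeOperator_ofLocal_apply_eq_of_le` (**level-independence of the unramified Hecke
  operators**, folklore): for levels `Kf' ≤ Kf ≤ K^max = {1} × GL_n(𝒪̂_K)` with `Kf'` maximal
  at `v` (`ι_v(GL_n(𝒪_v)) ≤ Kf'`, `IsMaximalAt`) and `x ∈ GL_n(K_v)`, the double-coset operators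
  `[Kf' ι_v(x) Kf']` and `[Kf ι_v(x) Kf]` agree on `Kf`-fixed vectors. Proof: for `k ∈ Kf`,
  `k ι_v(x) Kf = ι_v(k_v x) Kf` (`mk_mul_ofLocal_eq`: `k = ι_v(k_v) · k^v` with `k^v ∈ Kf`
  trivial at `v`, commuting with `ι_v(x)` by `GLn.ofLocal_mul_eq_mul_ofLocal_of_toLocal_eq_one`
  of `JacquetLanglandsParts`), so the projection `Kf' ι_v(x) Kf' / Kf' → Kf ι_v(x) Kf / Kf` is
  onto, and it is injective because local elements congruent modulo `Kf` are congruent modulo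
  `Kf'` (compare `v`-components); the generic change-of-level lemma
  `heckeOperator_apply_eq_of_le` of `JacquetLanglandsParts` (one transversal for both orbits,
  `heckeOperator_apply_eq_sum`; infinite orbits give the junk value `0` on both sides) then
  applies. This generalises `heckeOperator_sphericalLevelAt_eq_principalCongruenceLevel` of
  `JacquetLanglandsParts` (the pair `ι_v(GL_n(𝒪_v)) ≤ K(𝔫)`) to an arbitrary pair of levels
  maximal at `v`, which is what the passage `K(𝔫) → K(𝔫𝔫')` below needs. Consequences:
  `HasSatakeParameterAt.of_le` and `HasSatakeParameterAt.of_level_le` (**Satake parameters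
  pass from `K(𝔫)` to `K(𝔪)`, `0 ≠ 𝔪 ⊆ 𝔫`, at `v ∤ 𝔪`**), with `principalCongruenceLevel_mono`
  (`K(𝔪) ≤ K(𝔫)`, `FractionalIdeal.count_mono`) and `principalCongruenceLevel_zero`
  (`K(0) = K^max`, the junk level).
* `HasSatakeParameterAt.eq_of_ofLocal_eq_smul` (**Satake parameters of a cuspidal `Π` at `v`
  do not depend on the level**): under the named fact
  `Flath1979_heckeOperatorAt_ofLocal_eq_smul` of `UnramifiedHeckeScalars`, Satake parameters
  of `Π` at `v` with respect to `K(𝔫)` and to `K(𝔫')` (`v ∤ 𝔫𝔫'`) coincide — pass both to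
  `K(𝔫𝔫')` and use `HasSatakeParameterAt.unique_of_ofLocal_eq_smul`. So the multiset `α` is
  the Hecke matrix `t_{Π,v}` of Arthur–Clozel, Ch. 3, §1.
* `IsWeakBaseChangeLift.eventually_exists`, `isWeakBaseChangeLift_of_eventually_exists`,
  `isWeakBaseChangeLift_iff_eventually_exists` (**`IsWeakBaseChangeLift` is Definition 1.1
  for cuspidal representations**): `IsWeakBaseChangeLift π Π` quantifies relation (1.1),
  `t_{Π,w} = (t_{π,v})^{f(w|v)}`, over all pairs of levels; for cuspidal `π`, `Π` (under the
  Flath fact over `F` and `E`) it is equivalent to relation (1.1) for the Satake parameters read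
  at any ONE pair of non-zero levels at which they exist almost everywhere, i.e. to
  Definition 1.1 as printed ("(1.1) is satisfied for almost all finite primes `v, w`").
* `IsWeakBaseChangeLift.unique` (**uniqueness of the cuspidal weak lift**, Arthur–Clozel,
  end of the proof of Thm. 4.2 (a): "the uniqueness of `Π` is obvious by (2.4)"): two
  cuspidal `Π, Π'` in the same `L²_cusp(GL_n(𝔸_E) ⧸ A_G GL_n(E))` which are weak base-change
  lifts of the same `π` (any closed `π ≤ L²` over `F` with Satake parameters at one level
  almost everywhere) are *equal*, granted the tree's named facts over `E`:
  `Literature.NumberTheory.Automorphic.strong_multiplicity_one_gl` (Jacquet–Shalika (2.4) with multiplicity one, in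
  Satake-parameter form at a level maximal outside a finite `S`) and
  `exists_hasSatakeParameterAt_cofinite`. With the named fact of `Sweep1Proofs` this gives
  `existsUnique_cuspidal_weakLift_of_not_dvd`: for `E/F` Galois of prime degree `ℓ ∤ n`, a
  cuspidal `π` has a cuspidal weak lift, unique in its `L²_cusp` (Thm. 4.2 (a) restricted to
  the notions of the tree; `σ`-stability still not expressible).

The non-vacuity guard of `strong_multiplicity_one_gl` (a cofinite set of finite places of `E` is
non-empty) is `infinite_heightOneSpectrum` of `JacquetLanglandsParts`.

## Sources

* Level-independence and the local representatives of `Kf ι_v(x) Kf / Kf`: standard adelic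
  bookkeeping (Shimura, *Introduction to the arithmetic theory of automorphic functions*,
  Ch. 3, §3.1–3.2, commensurators and the decomposition of double cosets; Borel–Jacquet,
  Corvallis (1979), §4.6; Cartier, Corvallis (1979), §IV.1, the operators of
  `ℋ(GL_n(K_v), GL_n(𝒪_v))`); tagged folklore.
* Arthur–Clozel (1989), Ch. 3 (read from the held copy): §1, (1.1) and Def. 1.1 (weak lift:
  "(1.1) is satisfied for almost all finite primes `v, w`"); §2, (2.4) (Jacquet–Shalika,
  Amer. J. Math. 103 (1981), II, Thm. 4.4); Thm. 4.2 (a) and the last sentence of its proof in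
  §4, "We have proved part (a) of the Theorem—the uniqueness of `Π` is obvious by (2.4)".

## Design notes

* The level-independence theorem is proved for an arbitrary representation `ρ` of
  `GL_n(𝔸_K)` on a module (`heckeOperator` of `HeckeAlgebra`) and then specialised to closed
  subrepresentations of `L²` (`heckeOperatorAt`); only `Kf ≤ K^max` (to read off local
  components in `GL_n(𝒪_w)`) and `IsMaximalAt n K v Kf'` are assumed, no compactness or
  openness.
* `IsWeakBaseChangeLift.unique` does not need the Flath fact: the level-quantified definition
  of `IsWeakBaseChangeLift` already pins the Satake parameters of both lifts at the common
  level `K(𝔑𝔑')` to `(t_{π,v})^{f(w|v)}`; the uniformizer is moved by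
  `HasSatakeParameterAt.of_valuation_eq`. Its hypotheses are the named facts *as stated in the
  tree* (`def … : Prop`), so that discharging those facts discharges uniqueness.
* The file imports `JacquetLanglandsParts` only for its generic, quaternion-free lemmas
  `heckeOperator_apply_eq_of_le` (with `heckeOperator_eq_zero_of_infinite`),
  `GLn.ofLocal_mul_eq_mul_ofLocal_of_toLocal_eq_one` and `infinite_heightOneSpectrum` (flagged
  there as librarian candidates for `HeckeAlgebra` / a general number-field file); nothing on
  quaternion algebras is used. No instances, no `sorry`, no new definitions besides theorems.

## References

* J. Arthur, L. Clozel, *Simple algebras, base change, and the advanced theory of the trace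
  formula*, Ann. of Math. Stud. 120 (1989), Ch. 3, §1 (1.1), Def. 1.1; §2 (2.4); Thm. 4.2 (a)
  and its proof, §4 [ArthurClozelAMS120].
* H. Jacquet, J. Shalika, *On Euler products and the classification of automorphic
  representations II*, Amer. J. Math. 103 (1981), Thm. 4.4 [JacquetShalikaAJM1981].
* G. Shimura, *Introduction to the arithmetic theory of automorphic functions* (1971), Ch. 3
  [ShimuraIATAF1971].
* A. Borel, H. Jacquet, *Automorphic forms and automorphic representations*, Corvallis
  (1979), Part 1, §4.6 [BorelJacquetCorvallis1979].
* P. Cartier, *Representations of 𝔭-adic groups: a survey*, Corvallis (1979), Part 1, §IV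
  [CartierCorvallis1979].
-/

noncomputable section

open scoped MatrixGroups
open NumberField IsDedekindDomain MeasureTheory Filter

namespace Literature.NumberTheory.Automorphic

/-! ### Local–global bookkeeping for `ι_v : GL_n(K_v) → GL_n(𝔸_K)` -/

section LocalGlobal

variable {n : ℕ} {K : Type} [Field K] [NumberField K] {v : HeightOneSpectrum (𝓞 K)}

/-- The `v`-component of `ι_v(x)` is `x` (`GLn.toLocal_ofLocal`, in `GeneralLinearGroup.map`
form). [folklore] -/
theorem GLn.map_adeleEval_ofLocal (x : GL (Fin n) (v.adicCompletion K)) :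
    Matrix.GeneralLinearGroup.map (AdelicGroupData.adeleEval K v) (GLn.ofLocal n K v x) = x :=
  GLn.toLocal_ofLocal x

variable {Kf : Subgroup (GL (Fin n) (AdeleRing (𝓞 K) K))}

/-- Local components of elements of a level `Kf ≤ K^max` lie in `GL_n(𝒪_w)`
(`toLocal_mem_valuedCongruenceSubgroup_one`). [folklore] -/
theorem map_adeleEval_mem_valuedCongruenceSubgroup_one (hint : Kf ≤ glIntegralLevel n K)
    {k : GL (Fin n) (AdeleRing (𝓞 K) K)} (hk : k ∈ Kf) (w : HeightOneSpectrum (𝓞 K)) :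
    Matrix.GeneralLinearGroup.map (AdelicGroupData.adeleEval K w) k ∈
      valuedCongruenceSubgroup (Fin n) (1 : WithZero (Multiplicative ℤ)) :=
  toLocal_mem_valuedCongruenceSubgroup_one (hint hk) w

/-- For a level `Kf ≤ K^max` maximal at `v` and `k ∈ Kf`, the local piece `ι_v(k_v)` of `k`
lies in `Kf` (`k_v ∈ GL_n(𝒪_v)` and `ι_v(GL_n(𝒪_v)) ≤ Kf`). [folklore] -/
theorem ofLocal_map_adeleEval_mem (hKf : IsMaximalAt n K v Kf) (hint : Kf ≤ glIntegralLevel n K)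
    {k : GL (Fin n) (AdeleRing (𝓞 K) K)} (hk : k ∈ Kf) :
    GLn.ofLocal n K v (Matrix.GeneralLinearGroup.map (AdelicGroupData.adeleEval K v) k) ∈ Kf :=
  hKf ⟨_, map_adeleEval_mem_valuedCongruenceSubgroup_one hint hk v, rfl⟩

/-- **Left cosets of `Kf ι_v(x) Kf` have local representatives.** For a level `Kf ≤ K^max`
maximal at `v`, `k ∈ Kf` and `x ∈ GL_n(K_v)`: `k ι_v(x) Kf = ι_v(k_v x) Kf`, since
`k = ι_v(k_v) k^v` with `k^v ∈ Kf` trivial at `v`, and `k^v` commutes with `ι_v(x)`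
(so the double coset `Kf ι_v(x) Kf` is the union of the `ι_v(y) Kf`,
`y ∈ GL_n(𝒪_v) x GL_n(𝒪_v)`; Shimura, *Introduction to the arithmetic theory of automorphic
functions*, Ch. 3, §3.1–3.2). [folklore] -/
theorem mk_mul_ofLocal_eq (hKf : IsMaximalAt n K v Kf) (hint : Kf ≤ glIntegralLevel n K)
    {k : GL (Fin n) (AdeleRing (𝓞 K) K)} (hk : k ∈ Kf) (x : GL (Fin n) (v.adicCompletion K)) :
    ((k * GLn.ofLocal n K v x : GL (Fin n) (AdeleRing (𝓞 K) K)) :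
        GL (Fin n) (AdeleRing (𝓞 K) K) ⧸ Kf) =
      ((GLn.ofLocal n K v
          (Matrix.GeneralLinearGroup.map (AdelicGroupData.adeleEval K v) k * x) :
        GL (Fin n) (AdeleRing (𝓞 K) K)) : GL (Fin n) (AdeleRing (𝓞 K) K) ⧸ Kf) := by
  set t := Matrix.GeneralLinearGroup.map (AdelicGroupData.adeleEval K v) k with ht
  set k' := (GLn.ofLocal n K v t)⁻¹ * k with hk'
  have hk'v : Matrix.GeneralLinearGroup.map (AdelicGroupData.adeleEval K v) k' = 1 := by
    rw [hk', map_mul, map_inv, GLn.map_adeleEval_ofLocal, ← ht, inv_mul_cancel]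
  have hk'mem : k' ∈ Kf := Kf.mul_mem (Kf.inv_mem (ofLocal_map_adeleEval_mem hKf hint hk)) hk
  have hdec : k * GLn.ofLocal n K v x = GLn.ofLocal n K v (t * x) * k' := by
    rw [map_mul, mul_assoc, GLn.ofLocal_mul_eq_mul_ofLocal_of_toLocal_eq_one x hk'v, ← mul_assoc,
      ← mul_assoc, mul_inv_cancel, one_mul]
  rw [hdec, QuotientGroup.mk_mul_of_mem _ hk'mem]

end LocalGlobal

/-! ### Level-independence of the unramified Hecke operators -/

section Level

variable {n : ℕ} {K : Type} [Field K] [NumberField K] {v : HeightOneSpectrum (𝓞 K)}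
  {k V : Type*} [CommRing k] [AddCommGroup V] [Module k V]

/-- **The unramified Hecke operators at `v` do not depend on the level away from `v`.** Let
`Kf' ≤ Kf ≤ K^max` be levels of `GL_n(𝔸_K)` with `Kf'` (hence `Kf`) maximal at `v`, i.e.
containing `ι_v(GL_n(𝒪_v))`, and `x ∈ GL_n(K_v)`. Then on `Kf`-fixed vectors the double-coset
operators `[Kf' ι_v(x) Kf']` and `[Kf ι_v(x) Kf]` agree: both double cosets are the disjoint
unions of the left cosets `ι_v(y_j) Kf'`, resp. `ι_v(y_j) Kf`, over representatives `y_j` of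
`GL_n(𝒪_v) x GL_n(𝒪_v) / GL_n(𝒪_v)` (`mk_mul_ofLocal_eq`; two local elements congruent modulo
`Kf` are congruent modulo `Kf'`, comparing `v`-components), so both operators are
`∑_j ρ(ι_v(y_j))` (`heckeOperator_apply_eq_sum`); in the junk case of an infinite orbit both
are `0`. This is the compatibility `ℋ(GL_n(K_v), GL_n(𝒪_v)) → End(V^{Kf})` for all levels `Kf`
that are `GL_n(𝒪_v)` at `v` (Shimura, Ch. 3, §3.1–3.2; Borel–Jacquet, Corvallis (1979), §4.6).
[folklore] -/
theorem heckeOperator_ofLocal_apply_eq_of_le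
    (ρ : Representation k (GL (Fin n) (AdeleRing (𝓞 K) K)) V)
    {Kf Kf' : Subgroup (GL (Fin n) (AdeleRing (𝓞 K) K))} (hle : Kf' ≤ Kf)
    (hKf' : IsMaximalAt n K v Kf') (hint : Kf ≤ glIntegralLevel n K)
    (x : GL (Fin n) (v.adicCompletion K)) {f : V} (hf : f ∈ ρ.fixedPoints Kf) :
    heckeOperator ρ Kf' (GLn.ofLocal n K v x) f = heckeOperator ρ Kf (GLn.ofLocal n K v x) f := by
  have hKf : IsMaximalAt n K v Kf := hKf'.trans hle
  have hint' : Kf' ≤ glIntegralLevel n K := hle.trans hint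
  -- the local piece `ι_v(k_v)` of an element `k` of `Kf` lies in `Kf'`
  have hloc : ∀ {k' : GL (Fin n) (AdeleRing (𝓞 K) K)}, k' ∈ Kf →
      GLn.ofLocal n K v (Matrix.GeneralLinearGroup.map (AdelicGroupData.adeleEval K v) k') ∈ Kf' :=
    fun hk' => hKf' ⟨_, map_adeleEval_mem_valuedCongruenceSubgroup_one hint hk' v, rfl⟩
  -- two local elements congruent modulo `Kf` are congruent modulo `Kf'`
  have hcong : ∀ a b : GL (Fin n) (v.adicCompletion K),
      ((GLn.ofLocal n K v a : GL (Fin n) (AdeleRing (𝓞 K) K)) :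
          GL (Fin n) (AdeleRing (𝓞 K) K) ⧸ Kf) = (GLn.ofLocal n K v b : _) →
      ((GLn.ofLocal n K v a : GL (Fin n) (AdeleRing (𝓞 K) K)) :
          GL (Fin n) (AdeleRing (𝓞 K) K) ⧸ Kf') = (GLn.ofLocal n K v b : _) := by
    intro a b hab
    have hmem : GLn.ofLocal n K v (a⁻¹ * b) ∈ Kf := by
      rw [map_mul, map_inv]
      exact QuotientGroup.eq.mp hab
    have hmem' : GLn.ofLocal n K v (a⁻¹ * b) ∈ Kf' := by
      have := hloc hmem
      rwa [GLn.map_adeleEval_ofLocal] at this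
    rw [map_mul, map_inv] at hmem'
    exact QuotientGroup.eq.mpr hmem'
  refine heckeOperator_apply_eq_of_le ρ hle (GLn.ofLocal n K v x) (fun k hk => ?_)
    (fun k₁ hk₁ k₂ hk₂ h => ?_) hf
  · -- surjectivity: `k ι_v(x) Kf = ι_v(k_v x) Kf = ι_v(k_v) ι_v(x) Kf` with `ι_v(k_v) ∈ Kf'`
    refine ⟨_, hloc hk, ?_⟩
    rw [mk_mul_ofLocal_eq hKf hint hk x, map_mul]
  · -- injectivity: pass to local representatives and compare `v`-components
    rw [mk_mul_ofLocal_eq hKf hint (hle hk₁) x, mk_mul_ofLocal_eq hKf hint (hle hk₂) x] at h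
    rw [mk_mul_ofLocal_eq hKf' hint' hk₁ x, mk_mul_ofLocal_eq hKf' hint' hk₂ x]
    exact hcong _ _ h

variable {μ : Measure (AdelicGroupData.gl n K).automorphicQuotient}
  [SMulInvariantMeasure (AdelicGroupData.gl n K).Adelic
    (AdelicGroupData.gl n K).automorphicQuotient μ]

/-- Level-independence of the unramified Hecke operators on a closed subrepresentation
`W ≤ L²(GL_n(𝔸_K) ⧸ A_G GL_n(K))`: for levels `Kf' ≤ Kf ≤ K^max` with `Kf'` maximal at `v`
and `x ∈ GL_n(K_v)`, `[Kf' ι_v(x) Kf'] = [Kf ι_v(x) Kf]` on `W^{Kf}`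
(`heckeOperator_ofLocal_apply_eq_of_le`). [folklore] -/
theorem heckeOperatorAt_ofLocal_apply_eq_of_le
    (W : ContRepresentation.ClosedSubrep ((AdelicGroupData.gl n K).rightRegular μ))
    {Kf Kf' : Subgroup (GL (Fin n) (AdeleRing (𝓞 K) K))} (hle : Kf' ≤ Kf)
    (hKf' : IsMaximalAt n K v Kf') (hint : Kf ≤ glIntegralLevel n K)
    (x : GL (Fin n) (v.adicCompletion K)) {f : W.toSubmodule} (hf : f ∈ W.fixedVectors Kf) :
    heckeOperatorAt W Kf' (GLn.ofLocal n K v x) f = heckeOperatorAt W Kf (GLn.ofLocal n K v x) f :=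
  heckeOperator_ofLocal_apply_eq_of_le _ hle hKf' hint x hf

/-- **Satake parameters pass to smaller levels.** If `W` has Satake parameter `α` at `v` with
respect to a level `Kf ≤ K^max` (through a `Kf`-fixed common eigenvector `f` of the
`T_{v,i} = [Kf t_{v,i} Kf]`), then it has the same Satake parameter with respect to every
smaller level `Kf' ≤ Kf` still maximal at `v`: `f` is `Kf'`-fixed and
`[Kf' t_{v,i} Kf'] f = [Kf t_{v,i} Kf] f` (`t_{v,i} = ι_v(diag(ϖ,…,ϖ,1,…,1))`,
`heckeDiagAt_eq_ofLocal_glDiagonal`, and `heckeOperatorAt_ofLocal_apply_eq_of_le`).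
[folklore] -/
theorem HasSatakeParameterAt.of_le
    {W : ContRepresentation.ClosedSubrep ((AdelicGroupData.gl n K).rightRegular μ)}
    {Kf Kf' : Subgroup (GL (Fin n) (AdeleRing (𝓞 K) K))} (hle : Kf' ≤ Kf)
    (hKf' : IsMaximalAt n K v Kf') (hint : Kf ≤ glIntegralLevel n K)
    {ϖ : (v.adicCompletion K)ˣ} {α : Multiset ℂ} (h : HasSatakeParameterAt W Kf v ϖ α) :
    HasSatakeParameterAt W Kf' v ϖ α := by
  obtain ⟨hϖ, hcard, f, hf, hf0, hT⟩ := h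
  refine ⟨hϖ, hcard, f, W.fixedVectors_antitone hle hf, hf0, fun i hi => ?_⟩
  rw [heckeDiagAt_eq_ofLocal_glDiagonal, heckeOperatorAt_ofLocal_apply_eq_of_le W hle hKf' hint _ hf,
    ← heckeDiagAt_eq_ofLocal_glDiagonal]
  exact hT i hi

end Level

/-! ### Principal congruence subgroups: monotonicity in the level -/

section Principal

variable (n : ℕ) (K : Type) [Field K] [NumberField K]

/-- `|𝔪|_v ≤ |𝔫|_v` for non-zero ideals `𝔪 ⊆ 𝔫` (`ord_v 𝔫 ≤ ord_v 𝔪`, Mathlib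
`FractionalIdeal.count_mono`). [folklore] -/
theorem idealRadius_mono (v : HeightOneSpectrum (𝓞 K)) {𝔪 𝔫 : Ideal (𝓞 K)} (h𝔪 : 𝔪 ≠ 0)
    (h : 𝔪 ≤ 𝔫) : idealRadius K v 𝔪 ≤ idealRadius K v 𝔫 := by
  unfold idealRadius
  rw [WithZero.exp_le_exp, neg_le_neg_iff]
  refine FractionalIdeal.count_mono K v ?_ ((FractionalIdeal.coeIdeal_le_coeIdeal K).mpr h)
  exact FractionalIdeal.coeIdeal_ne_zero.mpr h𝔪

/-- `|0|_v = 1` (junk value of `idealRadius`: `count 0 = 0`). [folklore] -/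
@[simp]
theorem idealRadius_zero (v : HeightOneSpectrum (𝓞 K)) : idealRadius K v 0 = 1 := by
  rw [idealRadius, Submodule.zero_eq_bot, FractionalIdeal.coeIdeal_bot, FractionalIdeal.count_zero,
    neg_zero, WithZero.exp_zero]

/-- **The principal congruence subgroups decrease with the level**: `K(𝔪) ≤ K(𝔫)` for
non-zero ideals `𝔪 ⊆ 𝔫` of `𝓞 K`, e.g. `K(𝔫𝔫') ≤ K(𝔫)` (Godement–Jacquet, LNM 260, §10;
Shimura, Ch. 3). [folklore] -/
theorem principalCongruenceLevel_mono {𝔪 𝔫 : Ideal (𝓞 K)} (h𝔪 : 𝔪 ≠ 0) (h : 𝔪 ≤ 𝔫) :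
    principalCongruenceLevel n K 𝔪 ≤ principalCongruenceLevel n K 𝔫 := by
  intro g hg
  rw [mem_principalCongruenceLevel_iff] at hg ⊢
  exact ⟨hg.1, fun v => valuedCongruenceSubgroup_mono (Fin n) (idealRadius_mono K v h𝔪 h) (hg.2 v)⟩

/-- `K(0) = K^max = K(1)`: the junk level `0` is the full integral level
(`idealRadius_zero`; compare `principalCongruenceLevel_top`). [folklore] -/
theorem principalCongruenceLevel_zero :
    principalCongruenceLevel n K 0 = glIntegralLevel n K := by
  refine le_antisymm (principalCongruenceLevel_le n K 0) fun g hg => ?_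
  rw [mem_principalCongruenceLevel_iff]
  refine ⟨hg, fun v => ?_⟩
  rw [idealRadius_zero]
  exact toLocal_mem_valuedCongruenceSubgroup_one hg v

variable {n K}

/-- Every level `K(𝔫)` is a `K(𝔫₁)` with `𝔫₁ ≠ 0` (`𝔫₁ = 𝔫`, or `𝔫₁ = 𝓞 K` if `𝔫 = 0`,
`principalCongruenceLevel_zero`, `principalCongruenceLevel_top`). [folklore] -/
theorem exists_ne_zero_principalCongruenceLevel_eq (𝔫 : Ideal (𝓞 K)) :
    ∃ 𝔫₁ : Ideal (𝓞 K), 𝔫₁ ≠ 0 ∧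
      principalCongruenceLevel n K 𝔫 = principalCongruenceLevel n K 𝔫₁ := by
  rcases eq_or_ne 𝔫 0 with rfl | h
  · refine ⟨⊤, ?_, ?_⟩
    · rw [Ne, Submodule.zero_eq_bot]
      exact top_ne_bot
    · rw [principalCongruenceLevel_zero, principalCongruenceLevel_top]
  · exact ⟨𝔫, h, rfl⟩

variable {v : HeightOneSpectrum (𝓞 K)} {μ : Measure (AdelicGroupData.gl n K).automorphicQuotient}
  [SMulInvariantMeasure (AdelicGroupData.gl n K).Adelic
    (AdelicGroupData.gl n K).automorphicQuotient μ]

/-- **Satake parameters pass from level `K(𝔫)` to level `K(𝔪)`, `𝔪 ⊆ 𝔫`, at `v ∤ 𝔪`**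
(`𝔪 ≠ 0`; e.g. from `K(𝔫)` to `K(𝔫𝔫')` at `v ∤ 𝔫𝔫'`): `HasSatakeParameterAt.of_le` with
`K(𝔪) ≤ K(𝔫) ≤ K^max` and `K(𝔪)` maximal at `v` (`isMaximalAt_principalCongruenceLevel`).
[folklore] -/
theorem HasSatakeParameterAt.of_level_le
    {W : ContRepresentation.ClosedSubrep ((AdelicGroupData.gl n K).rightRegular μ)}
    {𝔪 𝔫 : Ideal (𝓞 K)} (h𝔪 : 𝔪 ≠ 0) (hle : 𝔪 ≤ 𝔫) (hv : ¬ v.asIdeal ∣ 𝔪)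
    {ϖ : (v.adicCompletion K)ˣ} {α : Multiset ℂ}
    (h : HasSatakeParameterAt W (principalCongruenceLevel n K 𝔫) v ϖ α) :
    HasSatakeParameterAt W (principalCongruenceLevel n K 𝔪) v ϖ α :=
  h.of_le (principalCongruenceLevel_mono n K h𝔪 hle)
    (isMaximalAt_principalCongruenceLevel n K v h𝔪 hv) (principalCongruenceLevel_le n K 𝔫)

end Principal

/-! ### Cuspidal representations: Satake parameters do not depend on the level -/

section Cuspidal

variable {n : ℕ} {K : Type} [Field K] [NumberField K]
  {μ : Measure (AdelicGroupData.gl n K).automorphicQuotient}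
  [(AdelicGroupData.gl n K).IsAutomorphicMeasure μ]

/-- **Satake parameters of a cuspidal representation do not depend on the level.** Under
`Flath1979_heckeOperatorAt_ofLocal_eq_smul` (the unramified local Hecke algebra acts by
scalars on `Π^{K(𝔫)}`), if a cuspidal `Π` has Satake parameter `α` at `v` with respect to
`K(𝔫)` and Satake parameter `β` at `v` with respect to `K(𝔫')` (`𝔫, 𝔫' ≠ 0`, `v ∤ 𝔫𝔫'`, any
eigenvectors, any uniformizers), then `α = β`: both pass to the common level `K(𝔫𝔫')`
(`HasSatakeParameterAt.of_level_le`), where Satake parameters are unique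
(`HasSatakeParameterAt.unique_of_ofLocal_eq_smul`). So `α = t_{Π,v}` is an invariant of `Π`
and `v` alone — the Hecke matrix of the unramified local component `Π_v` (Cartier, Corvallis
(1979), §IV; Borel–Jacquet, Corvallis (1979), §4.6). [cite: CartierCorvallis1979, §IV] -/
theorem HasSatakeParameterAt.eq_of_ofLocal_eq_smul
    (hF : Flath1979_heckeOperatorAt_ofLocal_eq_smul (n := n) (K := K) (μ := μ))
    (P : CuspidalAutomorphicRepGL n K μ) {𝔫 𝔫' : Ideal (𝓞 K)} (h𝔫 : 𝔫 ≠ 0) (h𝔫' : 𝔫' ≠ 0)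
    {v : HeightOneSpectrum (𝓞 K)} (hv : ¬ v.asIdeal ∣ 𝔫) (hv' : ¬ v.asIdeal ∣ 𝔫')
    {ϖ ϖ' : (v.adicCompletion K)ˣ} {α β : Multiset ℂ}
    (hα : HasSatakeParameterAt P.1 (principalCongruenceLevel n K 𝔫) v ϖ α)
    (hβ : HasSatakeParameterAt P.1 (principalCongruenceLevel n K 𝔫') v ϖ' β) : α = β := by
  have h0 : 𝔫 * 𝔫' ≠ 0 := mul_ne_zero h𝔫 h𝔫'
  have hv0 : ¬ v.asIdeal ∣ 𝔫 * 𝔫' := fun h => (v.prime.dvd_or_dvd h).elim hv hv'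
  exact HasSatakeParameterAt.unique_of_ofLocal_eq_smul hF P h0 hv0
    (hα.of_level_le h0 Ideal.mul_le_right hv0) (hβ.of_level_le h0 Ideal.mul_le_left hv0)

end Cuspidal

end Literature.NumberTheory.Automorphic

namespace Literature.NumberTheory.Automorphic


/-! ### Weak base-change lifts of cuspidal representations: one level suffices; uniqueness -/

section WeakLift

variable {n : ℕ} {F E : Type} [Field F] [NumberField F] [Field E] [NumberField E] [Algebra F E]

section General

variable {μ : Measure (AdelicGroupData.gl n F).automorphicQuotient}
  [SMulInvariantMeasure (AdelicGroupData.gl n F).Adelic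
    (AdelicGroupData.gl n F).automorphicQuotient μ]
  {ν : Measure (AdelicGroupData.gl n E).automorphicQuotient}
  [SMulInvariantMeasure (AdelicGroupData.gl n E).Adelic
    (AdelicGroupData.gl n E).automorphicQuotient ν]
  {W : ContRepresentation.ClosedSubrep ((AdelicGroupData.gl n F).rightRegular μ)}
  {W' : ContRepresentation.ClosedSubrep ((AdelicGroupData.gl n E).rightRegular ν)}

/-- **Relation (1.1) in existential form.** If `W'` is a weak base-change lift of `W`
(`IsWeakBaseChangeLift`: relation (1.1) for all Satake parameters at all pairs of levels,
eventually in `w`) and `W`, `W'` *have* Satake parameters at the levels `K(𝔫)`, `K(𝔑)` at all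
but finitely many places, then for all but finitely many `w`, with `v = w ∩ 𝓞 F` below `w`,
there are a Satake parameter `α` of `W` at `v` (level `K(𝔫)`) and the Satake parameter
`α ^ f(w|v)` of `W'` at `w` (level `K(𝔑)`): `t_{W',w} = (t_{W,v})^{f(w|v)}` for almost all `w`,
Arthur–Clozel's Definition 1.1 read at these levels (finite fibres of `w ↦ v`,
`tendsto_under_cofinite`). [cite: ArthurClozelAMS120, Ch. 3, §1, (1.1) and Def. 1.1] -/
theorem IsWeakBaseChangeLift.eventually_exists (h : IsWeakBaseChangeLift W W')
    {𝔫 : Ideal (𝓞 F)} {𝔑 : Ideal (𝓞 E)}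
    (hW : ∀ᶠ v : HeightOneSpectrum (𝓞 F) in cofinite,
      ∃ (ϖ : (v.adicCompletion F)ˣ) (α : Multiset ℂ),
        HasSatakeParameterAt W (principalCongruenceLevel n F 𝔫) v ϖ α)
    (hW' : ∀ᶠ w : HeightOneSpectrum (𝓞 E) in cofinite,
      ∃ (ϖ' : (w.adicCompletion E)ˣ) (β : Multiset ℂ),
        HasSatakeParameterAt W' (principalCongruenceLevel n E 𝔑) w ϖ' β) :
    ∀ᶠ w : HeightOneSpectrum (𝓞 E) in cofinite,
      ∃ (ϖ : ((w.under (𝓞 F)).adicCompletion F)ˣ) (ϖ' : (w.adicCompletion E)ˣ) (α : Multiset ℂ),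
        HasSatakeParameterAt W (principalCongruenceLevel n F 𝔫) (w.under (𝓞 F)) ϖ α ∧
          HasSatakeParameterAt W' (principalCongruenceLevel n E 𝔑) w ϖ'
            (α.map fun a => a ^ w.asIdeal.inertiaDeg (𝓞 F)) := by
  filter_upwards [(tendsto_under_cofinite (𝓞 F)).eventually hW, hW', h 𝔫 𝔑] with w hw hw' hrel
  obtain ⟨ϖ, α, hα⟩ := hw
  obtain ⟨ϖ', β, hβ⟩ := hw'
  obtain rfl := hrel ϖ ϖ' α β hα hβ
  exact ⟨ϖ, ϖ', α, hα, hβ⟩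

end General

section Cuspidal

variable {μ : Measure (AdelicGroupData.gl n F).automorphicQuotient}
  [(AdelicGroupData.gl n F).IsAutomorphicMeasure μ]
  {ν : Measure (AdelicGroupData.gl n E).automorphicQuotient}
  [(AdelicGroupData.gl n E).IsAutomorphicMeasure ν]

/-- **One pair of levels suffices for cuspidal representations.** Let `π` on `GL_n(𝔸_F)` and
`Π` on `GL_n(𝔸_E)` be cuspidal, and assume the unramified local Hecke algebras act by scalars
on fixed vectors (`Flath1979_heckeOperatorAt_ofLocal_eq_smul` over `F` and over `E`). If for
ONE pair of non-zero levels `𝔫₀`, `𝔑₀` and all but finitely many `w` there are a Satake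
parameter `α` of `π` at `v = w ∩ 𝓞 F` (level `K(𝔫₀)`) and the Satake parameter `α ^ f(w|v)` of
`Π` at `w` (level `K(𝔑₀)`) — Definition 1.1 of Arthur–Clozel read at these levels — then `Π`
is a weak base-change lift of `π` in the sense of `IsWeakBaseChangeLift` (relation (1.1) for
ALL pairs of levels): Satake parameters of a cuspidal representation at `v` do not depend on
the level `K(𝔫)`, `v ∤ 𝔫` (`HasSatakeParameterAt.eq_of_ofLocal_eq_smul`; the junk level `0`
is the level `𝓞 K`, `principalCongruenceLevel_zero`), and the finitely many `w` with `v ∣ 𝔫𝔫₀`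
or `w ∣ 𝔑𝔑₀` are discarded. [cite: ArthurClozelAMS120, Ch. 3, §1, Def. 1.1] -/
theorem isWeakBaseChangeLift_of_eventually_exists
    (hFF : Flath1979_heckeOperatorAt_ofLocal_eq_smul (n := n) (K := F) (μ := μ))
    (hFE : Flath1979_heckeOperatorAt_ofLocal_eq_smul (n := n) (K := E) (μ := ν))
    (P : CuspidalAutomorphicRepGL n F μ) (Q : CuspidalAutomorphicRepGL n E ν)
    {𝔫₀ : Ideal (𝓞 F)} (h𝔫₀ : 𝔫₀ ≠ 0) {𝔑₀ : Ideal (𝓞 E)} (h𝔑₀ : 𝔑₀ ≠ 0)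
    (h : ∀ᶠ w : HeightOneSpectrum (𝓞 E) in cofinite,
      ∃ (ϖ : ((w.under (𝓞 F)).adicCompletion F)ˣ) (ϖ' : (w.adicCompletion E)ˣ) (α : Multiset ℂ),
        HasSatakeParameterAt P.1 (principalCongruenceLevel n F 𝔫₀) (w.under (𝓞 F)) ϖ α ∧
          HasSatakeParameterAt Q.1 (principalCongruenceLevel n E 𝔑₀) w ϖ'
            (α.map fun a => a ^ w.asIdeal.inertiaDeg (𝓞 F))) :
    IsWeakBaseChangeLift P.1 Q.1 := by
  intro 𝔫 𝔑
  obtain ⟨𝔫₁, h𝔫₁, h𝔫K⟩ := exists_ne_zero_principalCongruenceLevel_eq (n := n) 𝔫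
  obtain ⟨𝔑₁, h𝔑₁, h𝔑K⟩ := exists_ne_zero_principalCongruenceLevel_eq (n := n) 𝔑
  have h1 : ∀ᶠ w : HeightOneSpectrum (𝓞 E) in cofinite, ¬ (w.under (𝓞 F)).asIdeal ∣ 𝔫₁ :=
    (tendsto_under_cofinite (𝓞 F)).eventually (Ideal.finite_factors h𝔫₁).compl_mem_cofinite
  have h2 : ∀ᶠ w : HeightOneSpectrum (𝓞 E) in cofinite, ¬ (w.under (𝓞 F)).asIdeal ∣ 𝔫₀ :=
    (tendsto_under_cofinite (𝓞 F)).eventually (Ideal.finite_factors h𝔫₀).compl_mem_cofinite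
  have h3 : ∀ᶠ w : HeightOneSpectrum (𝓞 E) in cofinite, ¬ w.asIdeal ∣ 𝔑₁ :=
    (Ideal.finite_factors h𝔑₁).compl_mem_cofinite
  have h4 : ∀ᶠ w : HeightOneSpectrum (𝓞 E) in cofinite, ¬ w.asIdeal ∣ 𝔑₀ :=
    (Ideal.finite_factors h𝔑₀).compl_mem_cofinite
  filter_upwards [h1, h2, h3, h4, h] with w hw1 hw2 hw3 hw4 hw ϖ₁ ϖ₁' α₁ β₁ hα₁ hβ₁
  obtain ⟨ϖ, ϖ', α, hα, hβ⟩ := hw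
  rw [h𝔫K] at hα₁
  rw [h𝔑K] at hβ₁
  rw [HasSatakeParameterAt.eq_of_ofLocal_eq_smul hFE Q h𝔑₁ h𝔑₀ hw3 hw4 hβ₁ hβ,
    HasSatakeParameterAt.eq_of_ofLocal_eq_smul hFF P h𝔫₁ h𝔫₀ hw1 hw2 hα₁ hα]

/-- **`IsWeakBaseChangeLift` is Arthur–Clozel's Definition 1.1 for cuspidal representations.**
Under `Flath1979_heckeOperatorAt_ofLocal_eq_smul` over `F` and `E`, for cuspidal `π`, `Π`
having Satake parameters at the non-zero levels `K(𝔫₀)`, `K(𝔑₀)` at all but finitely many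
places (as provided by `exists_hasSatakeParameterAt_cofinite`), `Π` is a weak base-change lift
of `π` iff `t_{Π,w} = (t_{π,v})^{f(w|v)}` for all but finitely many `w`, the Hecke matrices
being read at the levels `K(𝔫₀)`, `K(𝔑₀)` (`IsWeakBaseChangeLift.eventually_exists`,
`isWeakBaseChangeLift_of_eventually_exists`). [cite: ArthurClozelAMS120, Ch. 3, §1, Def. 1.1] -/
theorem isWeakBaseChangeLift_iff_eventually_exists
    (hFF : Flath1979_heckeOperatorAt_ofLocal_eq_smul (n := n) (K := F) (μ := μ))
    (hFE : Flath1979_heckeOperatorAt_ofLocal_eq_smul (n := n) (K := E) (μ := ν))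
    (P : CuspidalAutomorphicRepGL n F μ) (Q : CuspidalAutomorphicRepGL n E ν)
    {𝔫₀ : Ideal (𝓞 F)} (h𝔫₀ : 𝔫₀ ≠ 0) {𝔑₀ : Ideal (𝓞 E)} (h𝔑₀ : 𝔑₀ ≠ 0)
    (hP : ∀ᶠ v : HeightOneSpectrum (𝓞 F) in cofinite,
      ∃ (ϖ : (v.adicCompletion F)ˣ) (α : Multiset ℂ),
        HasSatakeParameterAt P.1 (principalCongruenceLevel n F 𝔫₀) v ϖ α)
    (hQ : ∀ᶠ w : HeightOneSpectrum (𝓞 E) in cofinite,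
      ∃ (ϖ' : (w.adicCompletion E)ˣ) (β : Multiset ℂ),
        HasSatakeParameterAt Q.1 (principalCongruenceLevel n E 𝔑₀) w ϖ' β) :
    IsWeakBaseChangeLift P.1 Q.1 ↔
      ∀ᶠ w : HeightOneSpectrum (𝓞 E) in cofinite,
        ∃ (ϖ : ((w.under (𝓞 F)).adicCompletion F)ˣ) (ϖ' : (w.adicCompletion E)ˣ)
          (α : Multiset ℂ),
          HasSatakeParameterAt P.1 (principalCongruenceLevel n F 𝔫₀) (w.under (𝓞 F)) ϖ α ∧
            HasSatakeParameterAt Q.1 (principalCongruenceLevel n E 𝔑₀) w ϖ'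
              (α.map fun a => a ^ w.asIdeal.inertiaDeg (𝓞 F)) :=
  ⟨fun h => h.eventually_exists hP hQ,
    isWeakBaseChangeLift_of_eventually_exists hFF hFE P Q h𝔫₀ h𝔑₀⟩

end Cuspidal

section Unique

variable {μ : Measure (AdelicGroupData.gl n F).automorphicQuotient}
  [SMulInvariantMeasure (AdelicGroupData.gl n F).Adelic
    (AdelicGroupData.gl n F).automorphicQuotient μ]
  {ν : Measure (AdelicGroupData.gl n E).automorphicQuotient}
  [(AdelicGroupData.gl n E).IsAutomorphicMeasure ν]

/-- **Uniqueness of the cuspidal weak base-change lift** (Arthur–Clozel, Ch. 3, Thm. 4.2 (a):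
"the uniqueness of `Π` is obvious by (2.4)", i.e. by strong multiplicity one). Let `π` be a
closed subrepresentation of `L²(GL_n(𝔸_F) ⧸ A_G GL_n(F))` having Satake parameters at some
level `K(𝔫)` at all but finitely many places (every cuspidal `π`,
`exists_hasSatakeParameterAt_cofinite`), and let `Π, Π'` be *cuspidal* automorphic
representations of `GL_n(𝔸_E)` (in the same `L²_cusp(GL_n(𝔸_E) ⧸ A_G GL_n(E))`) which are
both weak base-change lifts of `π`. Then `Π = Π'`, granted, over `E`: strong multiplicity one
in Satake-parameter form (`Literature.NumberTheory.Automorphic.strong_multiplicity_one_gl`, Jacquet–Shalika (2.4) with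
multiplicity one) and the existence of Satake parameters at one level almost everywhere
(`exists_hasSatakeParameterAt_cofinite`). Proof: with levels `𝔑` of
`Π` and `𝔑'` of `Π'`, at the common level `K(𝔑𝔑')` (maximal at `w ∤ 𝔑𝔑'`) and outside the
finite set `S` of bad places, `Π` and `Π'` have the same Satake parameters
`t_{Π,w} = (t_{π,v})^{f(w|v)} = t_{Π',w}` (level transfer `HasSatakeParameterAt.of_level_le`,
independence of the uniformizer `HasSatakeParameterAt.of_valuation_eq`); the non-vacuity guard
of `strong_multiplicity_one_gl` holds because `E` has infinitely many places
(`infinite_heightOneSpectrum`). [cite: ArthurClozelAMS120, Ch. 3, Thm. 4.2 (a) and its proof, §4] -/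
theorem IsWeakBaseChangeLift.unique
    (hSMO : strong_multiplicity_one_gl (n := n) (K := E) (μ := ν))
    (hexE : exists_hasSatakeParameterAt_cofinite (n := n) (K := E) (μ := ν))
    {W : ContRepresentation.ClosedSubrep ((AdelicGroupData.gl n F).rightRegular μ)}
    {𝔫 : Ideal (𝓞 F)}
    (hW : ∀ᶠ v : HeightOneSpectrum (𝓞 F) in cofinite,
      ∃ (ϖ : (v.adicCompletion F)ˣ) (α : Multiset ℂ),
        HasSatakeParameterAt W (principalCongruenceLevel n F 𝔫) v ϖ α)
    {Q Q' : CuspidalAutomorphicRepGL n E ν}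
    (hQ : IsWeakBaseChangeLift W Q.1) (hQ' : IsWeakBaseChangeLift W Q'.1) : Q = Q' := by
  haveI := infinite_heightOneSpectrum E
  obtain ⟨𝔑, h𝔑, hQs⟩ := hexE Q
  obtain ⟨𝔑', h𝔑', hQ's⟩ := hexE Q'
  have h𝔐 : 𝔑 * 𝔑' ≠ 0 := mul_ne_zero h𝔑 h𝔑'
  have hfin : ∀ᶠ w : HeightOneSpectrum (𝓞 E) in cofinite, ¬ w.asIdeal ∣ 𝔑 * 𝔑' :=
    (Ideal.finite_factors h𝔐).compl_mem_cofinite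
  -- the good places: everything holds
  have hG := (((tendsto_under_cofinite (𝓞 F)).eventually hW).and hfin).and
    ((hQs.and hQ's).and ((hQ 𝔫 (𝔑 * 𝔑')).and (hQ' 𝔫 (𝔑 * 𝔑'))))
  have hGfin := Filter.eventually_cofinite.mp hG
  set S : Finset (HeightOneSpectrum (𝓞 E)) := hGfin.toFinset with hS
  have hgood : ∀ w ∉ S, _ := fun w (hw : w ∉ S) =>
    not_not.mp fun h => hw (hGfin.mem_toFinset.mpr h)
  -- at a good place, the Satake parameters of `Q` and `Q'` at level `K(𝔑𝔑')` agree
  have key : ∀ w ∉ S, ∀ (Q₁ Q₂ : CuspidalAutomorphicRepGL n E ν) (𝔑₂ : Ideal (𝓞 E)),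
      𝔑 * 𝔑' ≤ 𝔑₂ →
      (∃ (ϖ' : (w.adicCompletion E)ˣ) (β : Multiset ℂ),
        HasSatakeParameterAt Q₂.1 (principalCongruenceLevel n E 𝔑₂) w ϖ' β) →
      (∀ (ϖ : ((w.under (𝓞 F)).adicCompletion F)ˣ) (ϖ' : (w.adicCompletion E)ˣ)
        (α β : Multiset ℂ),
        HasSatakeParameterAt W (principalCongruenceLevel n F 𝔫) (w.under (𝓞 F)) ϖ α →
          HasSatakeParameterAt Q₁.1 (principalCongruenceLevel n E (𝔑 * 𝔑')) w ϖ' β →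
            β = α.map fun a => a ^ w.asIdeal.inertiaDeg (𝓞 F)) →
      (∀ (ϖ : ((w.under (𝓞 F)).adicCompletion F)ˣ) (ϖ' : (w.adicCompletion E)ˣ)
        (α β : Multiset ℂ),
        HasSatakeParameterAt W (principalCongruenceLevel n F 𝔫) (w.under (𝓞 F)) ϖ α →
          HasSatakeParameterAt Q₂.1 (principalCongruenceLevel n E (𝔑 * 𝔑')) w ϖ' β →
            β = α.map fun a => a ^ w.asIdeal.inertiaDeg (𝓞 F)) →
      ∀ (ϖ : (w.adicCompletion E)ˣ) (β : Multiset ℂ),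
        HasSatakeParameterAt Q₁.1 (principalCongruenceLevel n E (𝔑 * 𝔑')) w ϖ β →
          HasSatakeParameterAt Q₂.1 (principalCongruenceLevel n E (𝔑 * 𝔑')) w ϖ β := by
    intro w hw Q₁ Q₂ 𝔑₂ hle hex₂ hrel₁ hrel₂ ϖ β hβ
    obtain ⟨⟨⟨ϖF, α, hα⟩, hw𝔐⟩, -⟩ := hgood w hw
    obtain ⟨ϖ₂, β₂, hβ₂⟩ := hex₂
    have hβ₂' := hβ₂.of_level_le h𝔐 hle hw𝔐
    have e₁ := hrel₁ ϖF ϖ α β hα hβ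
    have e₂ := hrel₂ ϖF ϖ₂ α β₂ hα hβ₂'
    rw [e₁, ← e₂]
    exact hβ₂'.of_valuation_eq (isMaximalAt_principalCongruenceLevel n E w h𝔐 hw𝔐) hβ.1
  refine hSMO Q Q' S (principalCongruenceLevel n E (𝔑 * 𝔑')) (fun w hw => ?_)
    (fun w hw ϖ β => ⟨fun hβ => ?_, fun hβ => ?_⟩) ?_
  · exact isMaximalAt_principalCongruenceLevel n E w h𝔐 (hgood w hw).1.2
  · obtain ⟨-, ⟨-, hQ'w⟩, hrel, hrel'⟩ := hgood w hw
    exact key w hw Q Q' 𝔑' Ideal.mul_le_left hQ'w hrel hrel' ϖ β hβ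
  · obtain ⟨-, ⟨hQw, -⟩, hrel, hrel'⟩ := hgood w hw
    exact key w hw Q' Q 𝔑 Ideal.mul_le_right hQw hrel' hrel ϖ β hβ
  · obtain ⟨w, hw⟩ := hG.exists
    have hwS : w ∉ S := fun h => (hGfin.mem_toFinset.mp h) hw
    obtain ⟨⟨-, hw𝔐⟩, ⟨⟨ϖ₁, β₁, hβ₁⟩, -⟩, -⟩ := hw
    exact ⟨w, hwS, ϖ₁, β₁, hβ₁.of_level_le h𝔐 Ideal.mul_le_right hw𝔐⟩

end Unique

section ExistsUnique

/-- **Arthur–Clozel, Thm. 4.2 (a) for `ℓ ∤ n`, with uniqueness.** For `E / F` Galois of prime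
degree `ℓ ∤ n` and `π` cuspidal on `GL_n(𝔸_F)`, there is a cuspidal weak base-change lift `Π`
of `π` on `GL_n(𝔸_E)`, unique inside its `L²_cusp(GL_n(𝔸_E) ⧸ A_G GL_n(E))`; from the named
facts `ArthurClozel1989_exists_cuspidal_weakLift_or_dvd` (existence, Thm. 4.2 (a)–(b)),
`exists_hasSatakeParameterAt_cofinite` over `F` and `E`, and `strong_multiplicity_one_gl`
over `E` (uniqueness "by (2.4)", `IsWeakBaseChangeLift.unique`).
[cite: ArthurClozelAMS120, Ch. 3, Thm. 4.2 (a)] -/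
theorem existsUnique_cuspidal_weakLift_of_not_dvd
    (hAC : ArthurClozel1989_exists_cuspidal_weakLift_or_dvd (n := n) (F := F) (E := E))
    (hF : ∀ (μ : Measure (AdelicGroupData.gl n F).automorphicQuotient)
      [(AdelicGroupData.gl n F).IsAutomorphicMeasure μ],
      exists_hasSatakeParameterAt_cofinite (n := n) (K := F) (μ := μ))
    (hE : ∀ (ν : Measure (AdelicGroupData.gl n E).automorphicQuotient)
      [(AdelicGroupData.gl n E).IsAutomorphicMeasure ν],
      exists_hasSatakeParameterAt_cofinite (n := n) (K := E) (μ := ν))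
    (hSMO : ∀ (ν : Measure (AdelicGroupData.gl n E).automorphicQuotient)
      [(AdelicGroupData.gl n E).IsAutomorphicMeasure ν],
      strong_multiplicity_one_gl (n := n) (K := E) (μ := ν))
    [IsGalois F E] (hℓ : (Module.finrank F E).Prime) (hn : ¬ Module.finrank F E ∣ n)
    (μ : Measure (AdelicGroupData.gl n F).automorphicQuotient)
    [(AdelicGroupData.gl n F).IsAutomorphicMeasure μ] (P : CuspidalAutomorphicRepGL n F μ) :
    ∃ (ν : Measure (AdelicGroupData.gl n E).automorphicQuotient)
      (_ : (AdelicGroupData.gl n E).IsAutomorphicMeasure ν),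
      ∃! Q : CuspidalAutomorphicRepGL n E ν, IsWeakBaseChangeLift P.1 Q.1 := by
  obtain ⟨ν, hν, Q, hQ⟩ := exists_cuspidal_weakLift_of_not_dvd hAC hℓ hn μ P
  obtain ⟨𝔫, -, hP⟩ := hF μ P
  exact ⟨ν, hν, Q, hQ, fun Q' hQ' =>
    (IsWeakBaseChangeLift.unique (hSMO ν) (hE ν) hP hQ hQ').symm⟩

end ExistsUnique

end WeakLift

end Literature.NumberTheory.Automorphic
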